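import Summits.ResolutionOfSingularities.ResolutionOfSingularities.Theorems.EquisingularLiftEquisingularLiftNatOutwardSectionLift
import Summits.ResolutionOfSingularities.ResolutionOfSingularities.Theorems.EquisingularLiftEquisingularLiftNatExceptionalLineCone
import HarnessLib

/-!
# [OURS · L1 W4.5(b) · EL♮(3)] `OutwardSectionLift`, the CONVERSE: off the outward section `E_{C′} ∩ St(T̃)` a point of the
# exceptional divisor is OFF the strict transform of `Y′`; the special trace of `St(Y′)` on `E_{C′}` IS the outward section's

Sequel of `…NatOutwardSectionLift.lean` (res-type-034; crux `EquisingularLiftNat` stmt-ResolutionOfSingularities-20038, child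
EL♮(3) stmt-ResolutionOfSingularities-20148, helper `--supports stmt-ResolutionOfSingularities-20148 --as helper`; res-plan-2
IDLE POOL DEAL #3 «W4.5b U3», res-L1-w45b-plan-1 CUTS 2026-08-27T08:54:30Z U3: «… conversely the section `V(t, ξ − ξ₀)` with
`ξ̄₀ ≠ 0` violates E1»). OURS: replaces the role of NOTHING in H. Hironaka's manuscript and is NOT a statement of it; AI-written
kernel lemmas of the cell `res-hironaka`, weaker than expert review. No definition is declared.

CONTENT (setting and names of `…NatOutwardSectionLift`: blow-up `τ` along `J`, carrier `K` with `K_{s₀} = (c_{j₀})`, running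
strict transform `(K_Y)_{s₀} = (ϖ, F)`, `F ≡ u·c_{j₀}² (mod (c)³ + ϖ)`):
* `not_mem_support_strictTransformIdeal_of_not_mem_outwardSection` — with `u` a UNIT of `𝒪_{X,s₀}`, a point of `τ⁻¹(supp J)`
  NOT on the outward section `supp (St_τ(K) ⊔ E)` is NOT in `supp (strictTransformIdeal τ J K_Y)`. On the chart `c_j` carrying
  the point, `c_{j₀}/c_j ∉ 𝔔` (res-type-100 `exists_stalk_strictTransformIdeal_sup_comap` with `Φ = T_{j₀}`); the controlled
  transform `F′` of `F − mϖ`, `(c_j)² F′ = F − mϖ` (H-CONE `exists_controlledTransform_doubledPlaneCone`, …NatExceptionalLineCone),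
  lies in the `c_j`-saturation of `(ϖ, F)` and is `≡ u (c_{j₀}/c_j)²` modulo `(c_j) ⊆ 𝔔`, a unit at `𝔔`; stub-1's
  `mem_support_strictTransformIdeal_iff_saturation_le` (…NatInCarrierE1 rev 2) then excludes the point.
* `support_strictTransform_sup_comap_inter_subset_outwardSection` — set form: `supp (St_τ(K_Y) ⊔ E) ∩ X'_sp ⊆ supp (St_τ(K) ⊔ E)`
  when the unit normal form holds at every point of `τ⁻¹(supp J) ∩ X'_sp`.
* `support_strictTransform_sup_comap_inter_eq_outwardSection` — THE EQUALITY OF SPECIAL TRACES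
  `supp (St_τ(K_Y) ⊔ E) ∩ X'_sp = supp (St_τ(K) ⊔ E) ∩ X'_sp` (with `mem_strictTransformSet_of_outwardSection` for `⊇`):
  plan-1's «`St Y ∩ E_C ∩ P′_k = V(t, ϖ, λξ²)`» read on sets — of all sections of `E_{C′} → C′` exactly the cone-direction one
  carries special points of `St(Y′)` (whitelist (c) of kill test #42, PREREG-K45d ADDENDUM-1 V1′).
References: as in the parent file (Stacks 0804 / 080E, Görtz–Wedhorn I (13.19), Atiyah–Macdonald 3.15) through the cited tree files.
-/

set_option linter.dupNamespace false -- mandated namespace `Summit.<Summit>.<Problem>` of this single-conjunct summit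

noncomputable section

open CategoryTheory CategoryTheory.Limits AlgebraicGeometry TopologicalSpace Topology IsLocalRing
open Literature.AlgebraicGeometry.Resolution

namespace Summit.ResolutionOfSingularities.ResolutionOfSingularities.Cruxes.EquisingularLiftNat.Sections

universe u

/-! ## The converse: off the outward section, a point of `E_{C′}` is OFF the strict transform of `Y′`

(res-L1-w45b-plan-1 CUTS 08:54:30Z, U3: «conversely the section `V(t, ξ − ξ₀)` with `ξ̄₀ ≠ 0` violates E1» — of the
sections of `E_{C′} → C′` only the cone-direction one lies on `St(Y′)`; here as the sharper pointwise statement that NO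
point of `E_{C′}` off `St(T̃)` lies on the schematic strict transform, when the sheet coefficient `u` is a unit.) -/

section Converse

variable {X X' : Scheme.{u}} {τ : X' ⟶ X} {J : X.IdealSheafData}

set_option maxHeartbeats 400000 in
/-- **Off the outward section, off the strict transform.** In the setting of `mem_strictTransformSet_of_outwardSection` but
with the sheet coefficient `u` a UNIT of `R = 𝒪_{X,τ x'}` (`F - u·c_{j₀}² ∈ (c)³ + (ϖ)`; no hypothesis on `ϖ` is needed): a
point `x'` over `supp J` which is NOT on the outward section `supp (St_τ(K) ⊔ E)` is NOT in the support of the schematic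
strict transform `strictTransformIdeal τ J K_Y`. (On the chart `c_j` that carries `x'` one has `c_{j₀}/c_j ∉ 𝔔`; the
controlled transform `F′` of `F − m ϖ`, `(c_j)² F′ = F − m ϖ` (H-CONE `exists_controlledTransform_doubledPlaneCone`), lies in
the `c_j`-saturation of `(ϖ, F)` and is `≡ u (c_{j₀}/c_j)²` modulo `(c_j) ⊆ 𝔔`, a unit at `𝔔`; then stub-1's
`mem_support_strictTransformIdeal_iff_saturation_le`.) [folklore; OURS assembly] -/
theorem not_mem_support_strictTransformIdeal_of_not_mem_outwardSection [IsLocallyNoetherian X'] (hτ : IsBlowup τ J)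
    (K KY : X.IdealSheafData) (x' : X') (hx'J : τ x' ∈ (J.support : Set X))
    (hx' : x' ∉ ((strictTransformIdeal τ J K ⊔ J.comap τ).support : Set X'))
    {r : ℕ} (c : Fin r → X.presheaf.stalk (τ x'))
    (hcJ : Ideal.span (Set.range c) = stalkIdeal J (τ x')) (hc : IsQuasiRegular c)
    [IsDomain (X.presheaf.stalk (τ x') ⧸ Ideal.span (Set.range c))]
    (j₀ : Fin r) (hK : stalkIdeal K (τ x') = Ideal.span {c j₀})
    {ϖ F u : X.presheaf.stalk (τ x')} (hunit : IsUnit u)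
    (hF : F - u * c j₀ ^ 2 ∈ Ideal.span (Set.range c) ^ 3 ⊔ Ideal.span {ϖ})
    (hKY : stalkIdeal KY (τ x') = Ideal.span {ϖ, F}) :
    x' ∉ ((strictTransformIdeal τ J KY).support : Set X') := by
  -- the dictionary at `x'` and the support criterion for the outward section
  have hΦ : MvPolynomial.map (Ideal.Quotient.mk (Ideal.span (Set.range c)))
      (MvPolynomial.X j₀ : MvPolynomial (Fin r) (X.presheaf.stalk (τ x'))) ≠ 0 := by
    rw [MvPolynomial.map_X]
    exact MvPolynomial.X_ne_zero j₀
  have hKΦ : stalkIdeal K (τ x') =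
      Ideal.span {MvPolynomial.eval c (MvPolynomial.X j₀ : MvPolynomial (Fin r) (X.presheaf.stalk (τ x')))} := by
    rw [MvPolynomial.eval_X, hK]
  obtain ⟨j, 𝔔, χ, e, hχ, he, h𝔔, -, -, -, hiff⟩ :=
    exists_stalk_strictTransformIdeal_sup_comap hτ K x' hx'J c hcJ hc (MvPolynomial.X j₀)
      (MvPolynomial.isHomogeneous_X _ j₀) hΦ hKΦ
  -- off the outward section: `c_{j₀}/c_j ∉ 𝔔`
  have hfrac : blowupAlgebra.frac c j j₀ ∉ 𝔔.asIdeal := fun h =>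
    hx' (hiff.mpr (by rwa [MvPolynomial.aeval_X]))
  -- `c_j/1 ∈ 𝔔` (the point lies over the centre) and `u/1 ∉ 𝔔` (`u` a unit)
  have hcj : algebraMap _ (blowupAlgebra (Ideal.span (Set.range c)) (c j)) (c j) ∈ 𝔔.asIdeal := by
    rw [← Ideal.mem_comap, h𝔔]
    have h := (mem_support_iff_stalkIdeal_le J (τ x')).mp hx'J
    rw [← hcJ] at h
    exact h (Ideal.subset_span (Set.mem_range_self j))
  have hu𝔔 : algebraMap _ (blowupAlgebra (Ideal.span (Set.range c)) (c j)) u ∉ 𝔔.asIdeal := fun h =>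
    𝔔.2.ne_top (Ideal.eq_top_of_isUnit_mem _ h (hunit.map _))
  -- split the congruence: `F - u c_{j₀}² = a + m ϖ`, `a ∈ (c)³`
  obtain ⟨a, ha, m, hm, hsum⟩ := Submodule.mem_sup.mp hF
  obtain ⟨m', rfl⟩ := Ideal.mem_span_singleton'.mp hm
  have hF₀ : (F - m' * ϖ) - u * c j₀ ^ 2 ∈ Ideal.span (Set.range c) ^ 3 := by
    have h0 : (F - m' * ϖ) - u * c j₀ ^ 2 = a := by
      have h1 : a + m' * ϖ = F - u * c j₀ ^ 2 := hsum
      linear_combination -h1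
    rw [h0]
    exact ha
  -- the controlled transform `F′` of `F - m ϖ` on the chart `c_j`
  obtain ⟨F', hF', hF'sub⟩ := exists_controlledTransform_doubledPlaneCone (Ideal.span (Set.range c)) (c j)
    (blowupAlgebra.mem_span_range c j₀) hF₀
  -- if `x'` were on the strict transform, the whole saturation — `F′` included — would lie in `𝔔`
  intro hx'St
  have hsat := (mem_support_strictTransformIdeal_iff_saturation_le KY x' c hcJ {ϖ, F} hKY j 𝔔 χ e hχ he).mp hx'St
  have hF'Q : F' ∈ 𝔔.asIdeal := by
    refine hsat F' 2 ?_
    rw [← hF', map_sub, map_mul]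
    refine Ideal.sub_mem _ (Ideal.mem_map_of_mem _ (Ideal.subset_span (by simp))) ?_
    exact Ideal.mul_mem_left _ _ (Ideal.mem_map_of_mem _ (Ideal.subset_span (by simp)))
  -- but `F′ ≡ u (c_{j₀}/c_j)²` modulo `(c_j/1) ⊆ 𝔔`
  have hsub𝔔 : F' - algebraMap _ (blowupAlgebra (Ideal.span (Set.range c)) (c j)) u *
      blowupAlgebra.frac c j j₀ ^ 2 ∈ 𝔔.asIdeal :=
    (Ideal.span_singleton_le_iff_mem _).mpr hcj hF'sub
  have hprod : algebraMap _ (blowupAlgebra (Ideal.span (Set.range c)) (c j)) u *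
      blowupAlgebra.frac c j j₀ ^ 2 ∈ 𝔔.asIdeal := by
    have h := Ideal.sub_mem _ hF'Q hsub𝔔
    rwa [sub_sub_cancel] at h
  rcases 𝔔.2.mem_or_mem hprod with h | h
  · exact hu𝔔 h
  · exact hfrac (𝔔.2.mem_of_pow_mem 2 h)

/-- **The special trace of `St(Y′)` on `E_{C′}` lies on the outward section** (set form of the converse): if at every point of
`τ⁻¹(supp J) ∩ X'_sp` the normal form of `not_mem_support_strictTransformIdeal_of_not_mem_outwardSection` is available
(sheet coefficient a unit: «equimultiple, type exactly `u·k₁²` at every special point of the curve»), then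
`supp (St_τ(K_Y) ⊔ E) ∩ X'_sp ⊆ supp (St_τ(K) ⊔ E)`. [folklore; OURS assembly] -/
theorem support_strictTransform_sup_comap_inter_subset_outwardSection [IsLocallyNoetherian X'] (hτ : IsBlowup τ J)
    (K KY : X.IdealSheafData) (Xsp : Set X')
    (hdata : ∀ x' ∈ τ ⁻¹' (J.support : Set X) ∩ Xsp,
      ∃ (r : ℕ) (c : Fin r → X.presheaf.stalk (τ x')) (j₀ : Fin r) (ϖ F u : X.presheaf.stalk (τ x')),
        Ideal.span (Set.range c) = stalkIdeal J (τ x') ∧ IsQuasiRegular c ∧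
        IsDomain (X.presheaf.stalk (τ x') ⧸ Ideal.span (Set.range c)) ∧
        stalkIdeal K (τ x') = Ideal.span {c j₀} ∧ IsUnit u ∧
        F - u * c j₀ ^ 2 ∈ Ideal.span (Set.range c) ^ 3 ⊔ Ideal.span {ϖ} ∧
        stalkIdeal KY (τ x') = Ideal.span {ϖ, F}) :
    ((strictTransformIdeal τ J KY ⊔ J.comap τ).support : Set X') ∩ Xsp ⊆
      ((strictTransformIdeal τ J K ⊔ J.comap τ).support : Set X') := by
  rintro x' ⟨hx', hsp⟩
  have hx'J : τ x' ∈ (J.support : Set X) := support_strictTransformIdeal_sup_comap_subset τ J KY hx'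
  have hx'St : x' ∈ ((strictTransformIdeal τ J KY).support : Set X') := by
    rw [Scheme.IdealSheafData.support_sup] at hx'
    exact hx'.1
  obtain ⟨r, c, j₀, ϖ, F, u, hcJ, hc, hdom, hK, hunit, hF, hKY⟩ := hdata x' ⟨hx'J, hsp⟩
  haveI := hdom
  by_contra hnot
  exact not_mem_support_strictTransformIdeal_of_not_mem_outwardSection hτ K KY x' hx'J hnot c hcJ hc j₀ hK hunit hF hKY
    hx'St

/-- **THE SPECIAL TRACE OF `St(Y′)` ON `E_{C′}` IS THE SPECIAL TRACE OF THE OUTWARD SECTION** (res-L1-w45b-plan-1's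
«`St Y ∩ E_C ∩ P′_k = V(t, ϖ, λξ²)`», set-theoretically): under the normal form of §2 with a UNIT sheet coefficient at every
special point over the centre, `supp (St_τ(K_Y) ⊔ E) ∩ X'_sp = supp (St_τ(K) ⊔ E) ∩ X'_sp`. [folklore; OURS assembly] -/
theorem support_strictTransform_sup_comap_inter_eq_outwardSection [IsLocallyNoetherian X'] (hτ : IsBlowup τ J)
    (K KY : X.IdealSheafData) (Xsp : Set X')
    (hdata : ∀ x' ∈ τ ⁻¹' (J.support : Set X) ∩ Xsp,
      ∃ (r : ℕ) (c : Fin r → X.presheaf.stalk (τ x')) (j₀ : Fin r) (ϖ F u : X.presheaf.stalk (τ x')),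
        Ideal.span (Set.range c) = stalkIdeal J (τ x') ∧ IsQuasiRegular c ∧
        IsDomain (X.presheaf.stalk (τ x') ⧸ Ideal.span (Set.range c)) ∧
        stalkIdeal K (τ x') = Ideal.span {c j₀} ∧
        ϖ ∉ Ideal.span (Set.range c) ∧ ϖ ∈ maximalIdeal (X.presheaf.stalk (τ x')) ∧
        (IsQuasiRegular fun l => Ideal.Quotient.mk (Ideal.span {ϖ}) (c l)) ∧
        IsDomain ((X.presheaf.stalk (τ x') ⧸ Ideal.span {ϖ}) ⧸
          Ideal.span (Set.range fun l => Ideal.Quotient.mk (Ideal.span {ϖ}) (c l))) ∧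
        IsUnit u ∧
        F - u * c j₀ ^ 2 ∈ Ideal.span (Set.range c) ^ 3 ⊔ Ideal.span {ϖ} ∧
        stalkIdeal KY (τ x') = Ideal.span {ϖ, F}) :
    ((strictTransformIdeal τ J KY ⊔ J.comap τ).support : Set X') ∩ Xsp =
      ((strictTransformIdeal τ J K ⊔ J.comap τ).support : Set X') ∩ Xsp := by
  apply le_antisymm
  · rintro x' ⟨hx', hsp⟩
    refine ⟨support_strictTransform_sup_comap_inter_subset_outwardSection hτ K KY Xsp ?_ ⟨hx', hsp⟩, hsp⟩
    intro y hy
    obtain ⟨r, c, j₀, ϖ, F, u, hcJ, hc, hdom, hK, -, -, -, -, hunit, hF, hKY⟩ := hdata y hy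
    exact ⟨r, c, j₀, ϖ, F, u, hcJ, hc, hdom, hK, hunit, hF, hKY⟩
  · rintro x' ⟨hx', hsp⟩
    have hx'J : τ x' ∈ (J.support : Set X) := support_strictTransformIdeal_sup_comap_subset τ J K hx'
    obtain ⟨r, c, j₀, ϖ, F, u, hcJ, hc, hdom, hK, hϖ, hϖ𝔪, hcbar, hdom', hunit, hF, hKY⟩ := hdata x' ⟨hx'J, hsp⟩
    haveI := hdom
    haveI := hdom'
    -- a unit is not in the proper ideal `(c̄)` of `R/ϖ`
    have hu : Ideal.Quotient.mk (Ideal.span {ϖ}) u ∉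
        Ideal.span (Set.range fun l => Ideal.Quotient.mk (Ideal.span {ϖ}) (c l)) := fun h =>
      Ideal.Quotient.zero_ne_one_iff.mp (zero_ne_one' ((X.presheaf.stalk (τ x') ⧸ Ideal.span {ϖ}) ⧸
        Ideal.span (Set.range fun l => Ideal.Quotient.mk (Ideal.span {ϖ}) (c l))))
        (Ideal.eq_top_of_isUnit_mem _ h (hunit.map _))
    have hmem := mem_strictTransformSet_of_outwardSection hτ K KY x' hx' c hcJ hc j₀ hK hϖ hϖ𝔪 hcbar hu hF hKY
    rw [← support_strictTransformIdeal_eq_closure τ J KY] at hmem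
    refine ⟨?_, hsp⟩
    rw [Scheme.IdealSheafData.support_sup]
    refine ⟨hmem, ?_⟩
    rw [Scheme.IdealSheafData.support_comap]
    exact hx'J

end Converse

end Summit.ResolutionOfSingularities.ResolutionOfSingularities.Cruxes.EquisingularLiftNat.Sections

end
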